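import Summits.BirchSwinnertonDyer.BirchSwinnertonDyer.Theses.CMKolyvaginAtInertTwo
import Summits.BirchSwinnertonDyer.BirchSwinnertonDyer.Theorems.CMKolyvaginAtInertTwoCMPrimitiveSupplyAtInertTwoOfKolyvaginConjecture
import HarnessLib

/-!
# Closer BY NAME of item 24649 `CMPrimitiveSupplyAtInertTwoOfFacts` (route CMKolyvaginAtInertTwo, rev 9/10):
# the primitive supply on H₂, relative to its three printed inputs and Kolyvagin's conjecture at 2

Seat `bsd-line-cmk2-p1` g5 (cell `bsd-print-cf2`). Summit-side THEOREM-ONLY file (one theorem; no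
definition, no named fact, no `sorry`).

The route pen (bsd-idea-1 g3, rev 9) filed the twin
`CMPrimitiveSupplyAtInertTwoOfFacts := (modularity ∧ Hoffstein–Luo ∧ GZ ∀N) → CMKolyvaginConjectureAtInertTwo
→ CMPrimitiveSupplyAtInertTwo` of the supply crux 24276 exactly as in the kernel-checked TURNKEY
`Cruxes/CMExactDescentAtTwo/TURNKEY_route_edit_24276.lean` (e). Its proof is ALREADY in the tree:
`Summit.BirchSwinnertonDyer.BirchSwinnertonDyer.Theorems.CMSupply.cmPrimitiveSupplyAtInertTwo_ofFacts`
(p599579, bsd-line-cmk2-p1 g3, over `cmPrimitiveSupplyAtInertTwo_of_kolyvaginConjectureAtTwo`,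
p594599; referee g5 2026-08-28T02:11Z: rc 0, trivial given p594599, candidate attached). This file
states the item's decl VERBATIM as the theorem's type and closes it by that constant.
CONDITIONAL content: none beyond the item's own antecedents (the three statement-only facts and the
crux `CMKolyvaginConjectureAtInertTwo` (stmt-24648, OPEN, research) are hypotheses OF THE ITEM, not
of this file). BSD is not proved by this; beyond-print theorem: NO (Gross 1991 §3/§11 bookkeeping +
Gross–Zagier + Hoffstein–Luo, done in the kernel by g3; the unprinted residue is exactly crux 24648).
-/

set_option autoImplicit false

namespace Summit.BirchSwinnertonDyer.BirchSwinnertonDyer.Theorems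

/-- **Item 24649 `CMPrimitiveSupplyAtInertTwoOfFacts`, closed BY NAME**: granted modularity
(`exists_isNewformOf`), the Hoffstein–Luo non-vanishing twist and Gross–Zagier at every level, and
granted Kolyvagin's conjecture at `p = 2` on the habitat H₂ (crux `CMKolyvaginConjectureAtInertTwo`),
every `E` in H₂ (CM, `2` inert in `F`, `ρ̄_{E,2}` onto, `r_an = 1`, odd Tamagawa product, an optimal
odd-Manin frame) has a Kolyvagin-(H2)-admissible Heegner field `K` (odd `d_K ≠ −3`, Heegner
hypothesis, the two non-square exclusions) with `y_K` of infinite order and exact `2`-divisibility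
exponent `M₀`, a square-free product `n` of Kolyvagin primes at `2` inert in `F` with `P(n) ∉ 2E(K[n])`,
and a globally minimal rank-`0` CM twin `Wd ≅ E^{(d_K)}`. Proof: the tree constant
`CMSupply.cmPrimitiveSupplyAtInertTwo_ofFacts`.
[cite: GrossLMS1991, §3 and §11 (Question)] [cite: GrossZagier1986, Thm. I.6.3]
[cite: HoffsteinLuo1997, Theorem] [cite: BCDTJAMS2001, Thm. A] -/
theorem cmPrimitiveSupplyAtInertTwoOfFacts_proof :
    Summit.BirchSwinnertonDyer.BirchSwinnertonDyer.Theses.CMKolyvaginAtInertTwo.CMPrimitiveSupplyAtInertTwoOfFacts :=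
  fun h hKC ↦ CMSupply.cmPrimitiveSupplyAtInertTwo_ofFacts h hKC

end Summit.BirchSwinnertonDyer.BirchSwinnertonDyer.Theorems
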